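import Literature.Barriers.HodgeConjecture.KaehlerCounterexamplesProofs
import Literature.Geometry.Kaehler.ComplexTorusZuckerJ
import Literature.AlgebraicGeometry.HodgeTheory.RationalLatticeIntegral
import Literature.AlgebraicGeometry.HodgeTheory.SupportedClassesRationalProofs
import HarnessLib

/-!
# Barrier fact `Zucker1977_kaehlerTorus_noAnalyticCycles`: assembly from de Rham's theorem and the absence of curves on a `J`-torus

Second proof file of `Literature/Barriers/HodgeConjecture/KaehlerCounterexamples` (after
`KaehlerCounterexamplesProofs`: the fact implies de Rham's theorem on `ℂ²`; naturality transports
`J^*`-eigenclasses; reduction of the witness to the tree's complex tori). Here the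
**cohomological half of Zucker's argument is proved outright** for the torus `T = ℂ²/Φ(ℤ^ι)` of a
`J`-lattice (`Φ ∘ A = J ∘ Φ` for an integer matrix `A`, Zucker p. 207 "`JL = L`"; the
de Rham side — `J^*J^* = id` on `H²_dR(T; ℂ)`, anti-invariant classes are of type `(1,1)`,
`J^* ≠ id` via `ω = dz ∧ dw̄` — is `Literature/Geometry/Kaehler/ComplexTorusZuckerJ.lean`), and
the fact is ASSEMBLED from exactly two leaves
(`Zucker1977_kaehlerTorus_noAnalyticCycles_of_leaves`):

1. de Rham's theorem with complex coefficients for manifolds charted on `ℂ²` — the named fact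
   `Literature.NumberTheory.Transcendental.exists_complexDeRhamIsoFamily (Fin 2 → ℂ)` (which the
   fact implies back, `Zucker1977_kaehlerTorus_noAnalyticCycles.exists_complexDeRhamIsoFamily`);
2. the absence of analytic hypersurfaces in `T` for a suitable (general) `J`-lattice — Zucker's
   Theorem p. 208 proper ("no effective analytic cycle can be homologous to zero on a compact
   Kähler manifold": cycle classes of analytic curves, Lelong, Kähler positivity), NOT in the tree
   and taken as the hypothesis `h₂`.

Singular side, proved here for any space with finitely generated `Hₖ(–; ℤ)` and `Hₖ(–; ℚ)`:
the integral classes span `Hᵏ(Y; ℂ)` over `ℂ` (`span_isIntegralClass_eq_top`, universal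
coefficients over `ℤ ⊂ ℚ ⊂ ℂ` from the tree's `IntegralLattice` / `SupportedClassesRationalProofs`),
so a pull-back which is not the identity moves some integral class
(`exists_isIntegralClass_map_ne`); and the homology of the compact `4`-manifold `T` is finitely
generated (`finite_singularHomology_complexTorus`, Hatcher App. A via the tree's
`finite_singularHomology_of_compact_chartedSpace`). With the transport lemmas of
`KaehlerCounterexamplesProofs`, `y - J^*y` is then a non-zero integral class of type `(1,1)` on the
compact Kähler surface `T`, for the natural comparison family of leaf 1.

## References

* S. Zucker, Compositio Math. 34 (1977) 199–209, Appendix B, Theorem p. 208. [Zucker1977]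
* A. Hatcher, *Algebraic Topology* (2002), §3.1 Thm. 3.2, p. 198; App. A Cor. A.8–A.9.
  [HatcherAT2002]
-/

noncomputable section

open scoped Manifold ContDiff Topology

namespace Literature.Barriers.HodgeConjecture

open Literature.AlgebraicGeometry.HodgeTheory Literature.AlgebraicTopology.SingularHomology
  Literature.NumberTheory.Transcendental Literature.Geometry.Kaehler singularCochainComplex

/-! ### The de Rham side on the torus of a `J`-lattice -/

section Torus

variable {ι : Type} [Fintype ι] (Φ : (ι → ℝ) ≃L[ℝ] (Fin 2 → ℂ)) (A : Matrix ι ι ℤ)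

/-- **Homomorphisms act on the complex classes of invariant forms through the analytic
representation**: `(mapMatrix A)^* [constForm Φ' c] = [constForm Φ (c ∘ realRep A)]` in
`H^k_dR(–; ℂ)` (the complex-coefficient companion of `ComplexTorus.map_constClass_mapMatrix`;
Lange–Birkenhake (1992), §1.1.4 / §1.1.2). [cite: LangeBirkenhake1992, §1.1.4] -/
theorem cmap_cconstClass_mapMatrix {ι' : Type} [Fintype ι'] (Φ' : (ι' → ℝ) ≃L[ℝ] (Fin 2 → ℂ))
    (B : Matrix ι' ι ℤ) {k : ℕ} (c : (Fin 2 → ℂ) [⋀^Fin k]→L[ℝ] ℂ) :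
    complexDeRhamCohomology.map (Fin 2 → ℂ)
        (ComplexTorus.contMDiff_real_mapMatrix (Φ := Φ) (Φ' := Φ') (n := ∞) B) k
        (ComplexTorus.cconstClass Φ' c) =
      ComplexTorus.cconstClass Φ (c.compContinuousLinearMap (ComplexTorus.realRep Φ Φ' B)) := by
  rw [ComplexTorus.cconstClass_apply, complexDeRhamCohomology.map_mk,
    ComplexTorus.cconstClass_apply]
  congr 1
  exact Subtype.ext (ComplexTorus.pullback_constForm_mapMatrix (Φ := Φ) (Φ' := Φ') B c)

/-- Every complex de Rham class of the torus is the class of an invariant form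
(Lange–Birkenhake (1992), Prop. 1.1.20, tree `ComplexTorus.cconstClassEquiv`).
[cite: LangeBirkenhake1992, Prop. 1.1.20] -/
theorem exists_eq_cconstClass {k : ℕ} (x : complexDeRhamCohomology (Fin 2 → ℂ) (ComplexTorus Φ) k) :
    ∃ c : (Fin 2 → ℂ) [⋀^Fin k]→L[ℝ] ℂ, x = ComplexTorus.cconstClass Φ c :=
  ⟨(ComplexTorus.cconstClassEquiv Φ).symm x, by
    rw [← ComplexTorus.cconstClassEquiv_apply, LinearEquiv.apply_symm_apply]⟩

/-- `cconstClass` is injective (it is the equivalence `cconstClassEquiv`).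
[cite: LangeBirkenhake1992, Prop. 1.1.20] -/
theorem cconstClass_injective {k : ℕ} :
    Function.Injective (ComplexTorus.cconstClass Φ (k := k)) := fun a b h ↦
  (ComplexTorus.cconstClassEquiv Φ).injective (by
    rwa [ComplexTorus.cconstClassEquiv_apply, ComplexTorus.cconstClassEquiv_apply])

/-! A **`J`-lattice** (Zucker: "a lattice `L` in `V` with `JL = L`", p. 207), in the tree's
coordinates, is a period isomorphism `Φ : ℝ^ι ≃ ℂ²` intertwining an integer matrix `A` with `J`,
`Φ ∘ A = J ∘ Φ` — the hypothesis `hA` below — so that `mapMatrix A` is the automorphism of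
`T = ℂ²/Φ(ℤ^ι)` induced by `J`. -/

variable {Φ A} (hA : ∀ x : ι → ℝ, Φ ((A.map (Int.cast : ℤ → ℝ)).mulVec x) = Zucker.J (Φ x))
include hA

/-- For a `J`-lattice the real analytic representation of `mapMatrix A` is `J`.
[cite: Zucker1977, Appendix B p. 207] -/
theorem realRep_eq_of_jLattice :
    ComplexTorus.realRep Φ Φ A = Zucker.J.restrictScalars ℝ := by
  ext1 z
  obtain ⟨x, rfl⟩ := Φ.surjective z
  rw [ComplexTorus.realRep_apply, hA x]
  rfl

/-- For a `J`-lattice, `J^*[constForm c] = [constForm (c ∘ J)]` on `H^k_dR(T; ℂ)`.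
[cite: Zucker1977, Appendix B p. 208] -/
theorem cmap_cconstClass_of_jLattice {k : ℕ}
    (c : (Fin 2 → ℂ) [⋀^Fin k]→L[ℝ] ℂ) :
    complexDeRhamCohomology.map (Fin 2 → ℂ)
        (ComplexTorus.contMDiff_real_mapMatrix (Φ := Φ) (Φ' := Φ) (n := ∞) A) k
        (ComplexTorus.cconstClass Φ c) =
      ComplexTorus.cconstClass Φ (c.compContinuousLinearMap (Zucker.J.restrictScalars ℝ)) := by
  rw [cmap_cconstClass_mapMatrix, realRep_eq_of_jLattice hA]

omit hA in
/-- `(c ∘ J) ∘ J = c` for a `2`-form `c` (`J² = -1` and `c(-u, -u') = c(u, u')`).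
[cite: Zucker1977, Appendix B p. 208] -/
theorem comp_J_comp_J (c : (Fin 2 → ℂ) [⋀^Fin 2]→L[ℝ] ℂ) :
    (c.compContinuousLinearMap (Zucker.J.restrictScalars ℝ)).compContinuousLinearMap
      (Zucker.J.restrictScalars ℝ) = c := by
  ext v
  change c (fun i ↦ Zucker.J (Zucker.J (v i))) = c v
  have e : (fun i ↦ Zucker.J (Zucker.J (v i))) = fun i ↦ (-1 : ℝ) • v i := by
    funext i; rw [Zucker.J_J, neg_one_smul]
  rw [e]
  have h := c.toContinuousMultilinearMap.map_smul_univ (fun _ ↦ (-1 : ℝ)) v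
  simpa using h

/-- **`J^*J^* = id` on `H²_dR(T; ℂ)`** for a `J`-lattice. [cite: Zucker1977, Appendix B p. 208] -/
theorem cmap_cmap_of_jLattice
    (x : complexDeRhamCohomology (Fin 2 → ℂ) (ComplexTorus Φ) 2) :
    complexDeRhamCohomology.map (Fin 2 → ℂ)
        (ComplexTorus.contMDiff_real_mapMatrix (Φ := Φ) (Φ' := Φ) (n := ∞) A) 2
        (complexDeRhamCohomology.map (Fin 2 → ℂ)
          (ComplexTorus.contMDiff_real_mapMatrix (Φ := Φ) (Φ' := Φ) (n := ∞) A) 2 x) = x := by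
  obtain ⟨c, rfl⟩ := exists_eq_cconstClass Φ x
  rw [cmap_cconstClass_of_jLattice hA, cmap_cconstClass_of_jLattice hA, comp_J_comp_J]

/-- **Anti-invariant classes are of type `(1, 1)`**: for a `J`-lattice, every `x ∈ H²_dR(T; ℂ)`
with `J^*x = -x` lies in `H^{1,1}(T)` (`hodgePQ … 2 1 1`), by `isConstOfType_one_one` and
`ComplexTorus.cconstClass_mem_hodgePQ`. [cite: Zucker1977, Appendix B p. 208] -/
theorem mem_hodgePQ_of_cmap_eq_neg_of_jLattice
    (x : complexDeRhamCohomology (Fin 2 → ℂ) (ComplexTorus Φ) 2)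
    (hx : complexDeRhamCohomology.map (Fin 2 → ℂ)
        (ComplexTorus.contMDiff_real_mapMatrix (Φ := Φ) (Φ' := Φ) (n := ∞) A) 2 x = -x) :
    x ∈ hodgePQ (Fin 2 → ℂ) (ComplexTorus Φ) 2 1 1 := by
  obtain ⟨c, rfl⟩ := exists_eq_cconstClass Φ x
  rw [cmap_cconstClass_of_jLattice hA, ← map_neg] at hx
  have hc : c.compContinuousLinearMap (Zucker.J.restrictScalars ℝ) = -c :=
    cconstClass_injective Φ hx
  refine ComplexTorus.cconstClass_mem_hodgePQ Φ (Zucker.isConstOfType_one_one c fun v ↦ ?_)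
  have h := congrArg (fun f : (Fin 2 → ℂ) [⋀^Fin 2]→L[ℝ] ℂ ↦ f v) hc
  exact h

/-- **`J^* ≠ id` on `H²_dR(T; ℂ)`** for a `J`-lattice: `J^*[ω] = -[ω] ≠ [ω]` for Zucker's
`ω = dz ∧ dw̄` (`Zucker.omega`). [cite: Zucker1977, Appendix B p. 208] -/
theorem exists_cmap_ne_of_jLattice :
    ∃ x : complexDeRhamCohomology (Fin 2 → ℂ) (ComplexTorus Φ) 2,
      complexDeRhamCohomology.map (Fin 2 → ℂ)
        (ComplexTorus.contMDiff_real_mapMatrix (Φ := Φ) (Φ' := Φ) (n := ∞) A) 2 x ≠ x := by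
  refine ⟨ComplexTorus.cconstClass Φ Zucker.omega, fun h ↦ Zucker.omega_ne_zero ?_⟩
  have hJ : Zucker.omega.compContinuousLinearMap (Zucker.J.restrictScalars ℝ) = -Zucker.omega := by
    ext v
    exact Zucker.omega_J v
  rw [cmap_cconstClass_of_jLattice hA, hJ, map_neg] at h
  have h2 : (2 : ℂ) • ComplexTorus.cconstClass Φ (k := 2) Zucker.omega = 0 := by
    rw [two_smul]
    nth_rewrite 1 [← h]
    exact neg_add_cancel _
  have h0 : ComplexTorus.cconstClass Φ (k := 2) Zucker.omega = 0 := by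
    simpa using h2
  exact cconstClass_injective Φ (by rw [h0, map_zero])

end Torus

/-! ### The singular side: integral classes span, and the homology of the torus is finite -/

/-- **Integral classes span `Hᵏ(Y; ℂ)` over `ℂ`** when `Hₖ(Y; ℤ)` and `Hₖ(Y; ℚ)` are finitely
generated (universal coefficients: rational classes span, `span_isRationalClass_eq_top`, and every
rational class has an integral multiple, `exists_smul_eq_π_baseChangeCocycle`; Hatcher (2002),
Thm. 3.2 and p. 198). [cite: HatcherAT2002, §3.1 Thm. 3.2 and p. 198] -/
theorem span_isIntegralClass_eq_top {Y : Type} [TopologicalSpace Y] (k : ℕ)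
    [Module.Finite ℤ (singularHomology ℤ ℤ Y k)] [Module.Finite ℚ (singularHomology ℚ ℚ Y k)] :
    Submodule.span ℂ {c : singularCohomology ℂ ℂ Y k | IsIntegralClass c} = ⊤ := by
  rw [eq_top_iff, ← span_isRationalClass_eq_top k, Submodule.span_le]
  rintro c (hc : IsRationalClass c)
  obtain ⟨ζ, rfl⟩ := hc.exists_cocycleOfRat
  obtain ⟨d, hd0, α, hα⟩ := exists_smul_eq_π_baseChangeCocycle ℤ ℚ k ζ
  have hd : IsIntegralClass ((d : ℂ) • singularCohomology.π ℂ ℂ _ k (cocycleOfRat _ k ζ)) := by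
    have h1 : singularCohomology.π ℚ ℚ _ k (baseChangeCocycle ℤ ℚ _ k α) =
        singularCohomology.π ℚ ℚ _ k ((d : ℚ) • ζ) := by
      rw [hα, map_smul, eq_intCast]
    have h2 := (π_cocycleOfRat_eq_iff _ _).2 h1
    rw [cocycleOfRat_smul, map_smul, Rat.cast_intCast] at h2
    rw [← h2]
    exact isIntegralClass_π_cocycleOfRat_baseChangeCocycle α
  have hd' : (d : ℂ) ≠ 0 := Int.cast_ne_zero.2 hd0
  have e : singularCohomology.π ℂ ℂ Y k (cocycleOfRat Y k ζ) =
      (d : ℂ)⁻¹ • ((d : ℂ) • singularCohomology.π ℂ ℂ Y k (cocycleOfRat Y k ζ)) := by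
    rw [smul_smul, inv_mul_cancel₀ hd', one_smul]
  rw [e]
  exact Submodule.smul_mem _ _ (Submodule.subset_span hd)

/-- **Some integral class is moved by `f^*` as soon as `f^* ≠ id` on `Hᵏ(Y; ℂ)`** (the integral
classes span). [cite: HatcherAT2002, §3.1 Thm. 3.2 and p. 198] -/
theorem exists_isIntegralClass_map_ne {Y : Type} [TopologicalSpace Y] {k : ℕ}
    [Module.Finite ℤ (singularHomology ℤ ℤ Y k)] [Module.Finite ℚ (singularHomology ℚ ℚ Y k)]
    (f : C(Y, Y)) (h : ∃ c : singularCohomology ℂ ℂ Y k, singularCohomology.map ℂ ℂ f k c ≠ c) :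
    ∃ y : singularCohomology ℂ ℂ Y k,
      IsIntegralClass y ∧ singularCohomology.map ℂ ℂ f k y ≠ y := by
  by_contra hne
  push Not at hne
  obtain ⟨c, hc⟩ := h
  apply hc
  have key : (singularCohomology.map ℂ ℂ f k).hom = LinearMap.id :=
    LinearMap.ext_on (span_isIntegralClass_eq_top k) fun y hy ↦ hne y hy
  exact congrArg (fun g : singularCohomology ℂ ℂ Y k →ₗ[ℂ] singularCohomology ℂ ℂ Y k ↦ g c) key

/-- **The singular homology of a complex `2`-torus is finitely generated** over any Noetherian
coefficient ring (it is a compact Hausdorff manifold charted on `ℂ² ≃ ℝ⁴`; Hatcher (2002), App. A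
Cor. A.8–A.9, tree `finite_singularHomology_of_compact_chartedSpace`).
[cite: HatcherAT2002, App. A Cor. A.8 and A.9 p. 527] -/
theorem finite_singularHomology_complexTorus (R : Type) [CommRing R] [IsNoetherianRing R]
    {ι : Type} [Fintype ι] (Φ : (ι → ℝ) ≃L[ℝ] (Fin 2 → ℂ)) (k : ℕ) :
    Module.Finite R (singularHomology R R (ComplexTorus Φ) k) := by
  let eC : (Fin 2 → ℂ) ≃ₜ EuclideanSpace ℝ (Fin 4) :=
    (ContinuousLinearEquiv.ofFinrankEq (𝕜 := ℝ) (by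
      rw [Module.finrank_pi_fintype, finrank_euclideanSpace_fin]
      simp [Complex.finrank_real_complex])).toHomeomorph
  letI : ChartedSpace (EuclideanSpace ℝ (Fin 4)) (ComplexTorus Φ) :=
    { atlas := Set.range fun P : ComplexTorus Φ ↦ (chartAt (Fin 2 → ℂ) P).transHomeomorph eC
      chartAt := fun P ↦ (chartAt (Fin 2 → ℂ) P).transHomeomorph eC
      mem_chart_source := fun P ↦ by
        rw [OpenPartialHomeomorph.transHomeomorph_source]; exact mem_chart_source _ P
      chart_mem_atlas := fun P ↦ ⟨P, rfl⟩ }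
  exact finite_singularHomology_of_compact_chartedSpace R R (d := 4) k

/-! ### Assembly: the fact from de Rham's theorem and the absence of curves on a `J`-torus -/

/-- **Zucker's counterexample, assembled from its two leaves.** Let `Φ : ℝ^ι ≃ ℂ²` be a
`J`-lattice (`hA`: `Φ ∘ A = J ∘ Φ` for an integer matrix `A`, `J(z, w) = (iz, -iw)` is
`Zucker.J`), `T = ℂ²/Φ(ℤ^ι)` its torus. ASSUME (leaf 1) de Rham's theorem with complex
coefficients for manifolds charted on `ℂ²` (the named fact
`exists_complexDeRhamIsoFamily (Fin 2 → ℂ)`, which the fact implies back,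
`Zucker1977_kaehlerTorus_noAnalyticCycles.exists_complexDeRhamIsoFamily`) and (leaf 2) that `T`
contains no analytic hypersurface (Zucker's Theorem, p. 208, for the general `J`-lattice: "no
effective analytic cycle can be homologous to zero on a compact Kähler manifold" — cycle classes
of analytic curves, not in the tree). THEN the barrier fact holds, with witness `T`: the
cohomological half is PROVED above — `J^*` is an involution of `H²_dR(T; ℂ)` whose anti-invariant
classes are of type `(1,1)` and which is not the identity, so (integral classes spanning
`H²(T; ℂ)`) some integral `y` has `J^*y ≠ y`, and `y - J^*y` is a non-zero integral class of type
`(1,1)` for the natural comparison family of leaf 1. [cite: Zucker1977, Appendix B Theorem p. 208] -/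
theorem Zucker1977_kaehlerTorus_noAnalyticCycles_of_leaves {ι : Type} [Fintype ι]
    (Φ : (ι → ℝ) ≃L[ℝ] (Fin 2 → ℂ)) (A : Matrix ι ι ℤ)
    (hA : ∀ x : ι → ℝ, Φ ((A.map (Int.cast : ℤ → ℝ)).mulVec x) = Zucker.J (Φ x))
    (h₁ : exists_complexDeRhamIsoFamily (Fin 2 → ℂ))
    (h₂ : ∀ Z : Set (ComplexTorus Φ), ¬ IsAnalyticHypersurface (E := Fin 2 → ℂ) Z) :
    Zucker1977_kaehlerTorus_noAnalyticCycles := by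
  obtain ⟨e, he⟩ := h₁
  have hJ : ContMDiff 𝓘(ℝ, Fin 2 → ℂ) 𝓘(ℝ, Fin 2 → ℂ) ∞ (ComplexTorus.mapMatrix Φ Φ A) :=
    ComplexTorus.contMDiff_real_mapMatrix A
  haveI := finite_singularHomology_complexTorus ℤ Φ 2
  haveI := finite_singularHomology_complexTorus ℚ Φ 2
  obtain ⟨y, hy, hJy⟩ := exists_isIntegralClass_map_ne ⟨_, hJ.continuous⟩
    (exists_singularCohomology_map_ne_of_deRham he hJ (exists_cmap_ne_of_jLattice hA))
  obtain ⟨cls, h1, h2, h3⟩ := exists_integral_ne_zero_isOfTypeOnManifold_of_involutive he hJ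
    (cmap_cmap_of_jLattice hA)
    (mem_hodgePQ_of_cmap_eq_neg_of_jLattice hA) hy hJy
  exact Zucker1977_kaehlerTorus_noAnalyticCycles.of_complexTorus Φ cls h1 h2 h3 h₂

end Literature.Barriers.HodgeConjecture

end
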